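import Mathlib
import Literature.Computability.AlgebraicComplexity.PrattTrapezoidVal
import Literature.Computability.AlgebraicComplexity.LocalStrongUSP
import Summits.MatrixMultiplication.MatrixMultiplication.Theorems.SoloBlindPrattValCyclic

/-!
# A balanced local strong USP of width 9 and size 13: `Val(ℤ/nℤ) ≥ 12 n` for nine coprime moduli `≥ 128`

Solo-blind line Q12 (Pratt, arXiv:2309.03878), eighth file.  Restricting this seat's SAT search for
local strong USPs (CKSU 2005 §6.1) to rows with exactly three of each symbol found size `13` at width
`9` in 87 s (per-coordinate rate `13^{1/9} ≈ 1.3297`, improving the `11^{1/9} ≈ 1.305` of the seventh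
file; all record puzzles found so far have balanced row compositions).  Kernel-verified by `decide`,
with the corollaries `13 · ∏ⱼ (mⱼ − 1) ≤ Val(ℤ/nℤ)` for nine pairwise coprime moduli, `Val(ℤ/nℤ) ≥ 12 n`
when all nine moduli are `≥ 128` (`13 · (127/128)^9 > 12`), and `Val(K⁹) ≥ 13 (|K| − 1)⁹`.
-/

set_option linter.dupNamespace false
set_option maxRecDepth 4000

namespace Summit.MatrixMultiplication.MatrixMultiplication.Theorems

open Finset Literature.Computability.AlgebraicComplexity

/-- The balanced width-9 local strong USP of size 13 found by SAT search (symbols `1,2,3` coded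
`0,1,2`): `333222111, 332321211, 332211231, 323211213, 322321131, 322312113, 322211133, 133322211, 133212213, 132312231, 123322131, 123321213, 123221133`. -/
theorem soloVal_isLocalStrongUSP_width9_size13 :
    IsLocalStrongUSP
      ![![(2 : Fin 3), 2, 2, 1, 1, 1, 0, 0, 0],
      ![(2 : Fin 3), 2, 1, 2, 1, 0, 1, 0, 0],
      ![(2 : Fin 3), 2, 1, 1, 0, 0, 1, 2, 0],
      ![(2 : Fin 3), 1, 2, 1, 0, 0, 1, 0, 2],
      ![(2 : Fin 3), 1, 1, 2, 1, 0, 0, 2, 0],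
      ![(2 : Fin 3), 1, 1, 2, 0, 1, 0, 0, 2],
      ![(2 : Fin 3), 1, 1, 1, 0, 0, 0, 2, 2],
      ![(0 : Fin 3), 2, 2, 2, 1, 1, 1, 0, 0],
      ![(0 : Fin 3), 2, 2, 1, 0, 1, 1, 0, 2],
      ![(0 : Fin 3), 2, 1, 2, 0, 1, 1, 2, 0],
      ![(0 : Fin 3), 1, 2, 2, 1, 1, 0, 2, 0],
      ![(0 : Fin 3), 1, 2, 2, 1, 0, 1, 0, 2],
      ![(0 : Fin 3), 1, 2, 1, 1, 0, 0, 2, 2]] := by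
  unfold IsLocalStrongUSP localStrongUSPPatterns
  decide

/-- **Nine-modulus block, size 13.**  For pairwise coprime moduli `m₀, …, m₈ ≥ 1` with product `n`:
`13 · ∏ⱼ (mⱼ − 1) ≤ Val(ℤ/nℤ)`. -/
theorem soloVal_nineBlock13 (m : Fin 9 → ℕ) (hm0 : ∀ j, m j ≠ 0)
    (hm : Pairwise (Function.onFun Nat.Coprime m)) (n : ℕ) [NeZero n] (hn : n = ∏ j, m j) :
    13 * ∏ j, (m j - 1) ≤ prattVal (ZMod n) :=
  soloVal_le_prattVal_zmod_of_isLocalStrongUSP soloVal_isLocalStrongUSP_width9_size13 m hm0 hm n hn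

/-- **Nine coprime moduli `≥ 128` give `Val(ℤ/nℤ) ≥ 12 n`** (`13 · (127/128)^9 > 12`). -/
theorem soloVal_nineBlock13_ge128 (m : Fin 9 → ℕ) (h128 : ∀ j, 128 ≤ m j)
    (hm : Pairwise (Function.onFun Nat.Coprime m)) (n : ℕ) [NeZero n] (hn : n = ∏ j, m j) :
    12 * n ≤ prattVal (ZMod n) := by
  have h := soloVal_nineBlock13 m (fun j => by have := h128 j; omega) hm n hn
  have hprod : ∏ j, (127 * m j) ≤ ∏ j, (128 * (m j - 1)) :=
    Finset.prod_le_prod' fun j _ => by have := h128 j; omega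
  rw [Finset.prod_mul_distrib, Finset.prod_mul_distrib, Finset.prod_const, Finset.prod_const,
    Finset.card_univ, Fintype.card_fin, ← hn] at hprod
  obtain ⟨P, hP⟩ : ∃ P, ∏ j, (m j - 1) = P := ⟨_, rfl⟩
  rw [hP] at h hprod
  norm_num at hprod
  omega

/-- **`13 · (|K| − 1)⁹ ≤ Val(K⁹)`** for every finite abelian group `K`. -/
theorem soloVal_ninth_le_prattVal13 (K : Type*) [AddCommGroup K] [Fintype K] [DecidableEq K] :
    13 * (Fintype.card K - 1) ^ 9 ≤ prattVal (Fin 9 → K) := by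
  have h := soloVal_le_prattVal_pi_of_isLocalStrongUSP (K := fun _ : Fin 9 => K)
    soloVal_isLocalStrongUSP_width9_size13
  simpa [Finset.prod_const, Finset.card_univ, Fintype.card_fin] using h

end Summit.MatrixMultiplication.MatrixMultiplication.Theorems
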